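import Literature.Geometry.Riemannian.RicciDeTurckShortTime
import HarnessLib

/-!
# Short-time existence of the Ricci flow: the one remaining leaf, named
# (fact decomposition of `ricciFlow_shortTime_existence`, 2026-08-16)

Topic `Geometry/Riemannian`. The named fact
`Literature.Geometry.Riemannian.ricciFlow_shortTime_existence` (`RicciFlow.lean`; Hamilton 1982,
Thm. 4.2; DeTurck 1983; Topping 2006, Thm. 5.2.1: every smooth Riemannian metric on a closed
manifold is the initial value of a Ricci flow on some `[0, ε]`) has been reduced in the tree, with
all glue PROVED, to a single analytic input: `RicciFlowExistenceReduction.lean` (Topping §5.2,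
Steps 1–2: Ricci flow from the Ricci–DeTurck flow by pulling back along the DeTurck
diffeomorphisms), `RicciDeTurckShortTime.lean` (Step 1: the Ricci–DeTurck flow as a quasilinear
strictly parabolic system with scalar principal part for plain vector-valued maps, via the graph
trick of `MetricAssembly.lean` and the structure theorem of `RicciDeTurckSystemStructure.lean`) —
`ricciFlow_shortTime_existence_of_quasilinear (hQL)`. The input `hQL` is the local existence
theorem for quasilinear strictly parabolic second-order systems with scalar principal part on a
closed manifold (Mantegazza–Martinazzi 2012, Thm. 1.1 with the remark on systems, p. 858; Taylor,
*PDE III*, Ch. 15, §7), a published theorem in its own right, distinct from Hamilton's (it knows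
nothing about metrics or curvature) and reusable (harmonic map heat flow, mean curvature flow,
Yamabe flow all start from it).

This file NAMES that input as the fact `quasilinearParabolic_shortTime_existence` (its body is the
hypothesis `hQL` of `ricciFlow_shortTime_existence_of_quasilinear`, verbatim) and records the
assembly `ricciFlow_shortTime_existence_holds_of : quasilinearParabolic_shortTime_existence →
ricciFlow_shortTime_existence` (proved: it IS `ricciFlow_shortTime_existence_of_quasilinear`).
The discharge `ricciFlow_shortTime_existence_holds` is
`ricciFlow_shortTime_existence_holds_of quasilinearParabolic_shortTime_existence_holds` once the
child is proved (linear parabolic theory on closed manifolds — `LinearHeatCauchyExistence.lean`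
already proves the scalar linear heat-type Cauchy problem — plus the quasilinear iteration,
Mantegazza–Martinazzi §2–§3: linearisation, Schauder/`L²` estimates for the linear system with
`C^∞` coefficients, contraction in a parabolic Hölder space, bootstrap).

## References

* C. Mantegazza, L. Martinazzi, *A note on quasilinear parabolic equations on manifolds*,
  Ann. Sc. Norm. Super. Pisa Cl. Sci. (5) 11 (2012) 857–874, Thm. 1.1 and p. 858.
  [MantegazzaMartinazzi2012]
* M. E. Taylor, *Partial differential equations III. Nonlinear equations*, 2nd ed., Applied
  Math. Sciences 117, Springer 2011, Ch. 15, §7 (local existence for quasilinear parabolic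
  systems). [TaylorPDEIII2011]
* R. S. Hamilton, *Three-manifolds with positive Ricci curvature*, J. Differential Geom. 17
  (1982), Thm. 4.2. [Hamilton1982]
* P. Topping, *Lectures on the Ricci flow*, LMS LNS 325 (2006), §5.2 and Thm. 5.2.1. [Topping2006]
-/

noncomputable section

open Bundle Set Function Filter
open scoped Manifold ContDiff Topology

namespace Literature.Geometry.Riemannian

universe u v w

/-- **Short-time existence for quasilinear strictly parabolic second-order systems with scalar
principal part on a closed manifold** (Mantegazza–Martinazzi 2012, Thm. 1.1: "Let `M` be a smooth
compact manifold … `u_t = Q[u]`, `Q` quasilinear, strongly elliptic with smooth coefficients … then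
for every `u₀ ∈ C^∞` there exists `T > 0` and a unique smooth solution on `[0, T)` with
`u(0) = u₀`", with the remark on p. 858 that the proof covers systems whose principal part is a
scalar elliptic operator times the identity; Taylor, *PDE III*, Ch. 15, §7), in the chart-wise
form consumed by `ricciFlow_shortTime_existence_of_quasilinear` (VERBATIM its hypothesis `hQL`).
Data: a closed manifold `M` (model `E`, charts `H`), a finite-dimensional target `W`, a basis `b`
of `E`, an open admissible set `𝒪 ⊆ M × W`, an operator `P` on maps `M → W`, and for every point
`z` coefficient functions `a z : E × W × (E →L W) → ι → ι → ℝ` (scalar principal part) and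
`f z : E × W × (E →L W) → W`, `C^∞` on the jet domain
`{(y, w, p) | y ∈ φ_z.target, (φ_z⁻¹ y, w) ∈ 𝒪}` of the extended chart `φ_z`, with `a z` symmetric
and positive definite there, such that for every `C^∞` map `u` with graph in `𝒪` and every `z`,
`P u (φ_z⁻¹ y) = ∑ᵢᵢ' a z (jet of u ∘ φ_z⁻¹ at y) i i' • D²(u ∘ φ_z⁻¹)(y)(bᵢ, bᵢ') + f z (jet)`
on `φ_z.target`. Conclusion: every `C^∞` map `u₀ : M → W` with graph in `𝒪` is the initial value
of some `u`, `C^∞` on `M × [0, ε]` for some `ε > 0`, with graph in `𝒪` at all times and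
`∂ₜu = P (u(t))` on `[0, ε]` (one-sided derivative within `[0, ε]`). The coefficients being
defined only on an open jet domain containing the compact set of initial jets, the printed
theorem is applied after a cutoff modification of `a`, `f` away from that set (the solution stays
in the unmodified region for short time). Users take
`(h : quasilinearParabolic_shortTime_existence)`.
[cite: MantegazzaMartinazzi2012, Thm. 1.1 and p. 858] [cite: TaylorPDEIII2011, Ch. 15, §7] -/
def quasilinearParabolic_shortTime_existence : Prop :=
  ∀ {E : Type u} [NormedAddCommGroup E] [NormedSpace ℝ E] [FiniteDimensional ℝ E]
    [CompleteSpace E] {H : Type v} [TopologicalSpace H] (I : ModelWithCorners ℝ E H)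
    [I.Boundaryless] (M : Type w) [TopologicalSpace M] [T2Space M] [SecondCountableTopology M]
    [CompactSpace M] [ChartedSpace H M] [IsManifold I ∞ M]
    {W : Type u} [NormedAddCommGroup W] [NormedSpace ℝ W] [FiniteDimensional ℝ W]
    {ι : Type} [Fintype ι] [DecidableEq ι] (b : Module.Basis ι ℝ E)
    (𝒪 : Set (M × W)) (_ : IsOpen 𝒪) (P : (M → W) → M → W)
    (a : M → E × W × (E →L[ℝ] W) → ι → ι → ℝ) (f : M → E × W × (E →L[ℝ] W) → W),
    (∀ z i i', ContDiffOn ℝ ∞ (fun j ↦ a z j i i')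
      {j | j.1 ∈ (extChartAt I z).target ∧ ((extChartAt I z).symm j.1, j.2.1) ∈ 𝒪}) →
    (∀ z, ContDiffOn ℝ ∞ (f z)
      {j | j.1 ∈ (extChartAt I z).target ∧ ((extChartAt I z).symm j.1, j.2.1) ∈ 𝒪}) →
    (∀ z (j : E × W × (E →L[ℝ] W)), j.1 ∈ (extChartAt I z).target →
      ((extChartAt I z).symm j.1, j.2.1) ∈ 𝒪 →
        (∀ i i', a z j i i' = a z j i' i) ∧
          ∀ ξ : ι → ℝ, ξ ≠ 0 → 0 < ∑ i, ∑ i', a z j i i' * ξ i * ξ i') →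
    (∀ u : M → W, ContMDiff I 𝓘(ℝ, W) ∞ u → (∀ x, (x, u x) ∈ 𝒪) →
      ∀ z, ∀ y ∈ (extChartAt I z).target,
        P u ((extChartAt I z).symm y) =
          (∑ i, ∑ i', a z (y, u ((extChartAt I z).symm y), fderiv ℝ (u ∘ (extChartAt I z).symm) y)
              i i' • fderiv ℝ (fderiv ℝ (u ∘ (extChartAt I z).symm)) y (b i) (b i')) +
            f z (y, u ((extChartAt I z).symm y), fderiv ℝ (u ∘ (extChartAt I z).symm) y)) →
    ∀ u₀ : M → W, ContMDiff I 𝓘(ℝ, W) ∞ u₀ → (∀ x, (x, u₀ x) ∈ 𝒪) →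
      ∃ ε : ℝ, 0 < ε ∧ ∃ u : M → ℝ → W,
        ContMDiffOn (I.prod 𝓘(ℝ, ℝ)) 𝓘(ℝ, W) ∞ (fun p : M × ℝ ↦ u p.1 p.2) (univ ×ˢ Icc 0 ε) ∧
        (∀ x, u x 0 = u₀ x) ∧ (∀ t ∈ Icc (0 : ℝ) ε, ∀ x, (x, u x t) ∈ 𝒪) ∧
        ∀ t ∈ Icc (0 : ℝ) ε, ∀ x,
          HasDerivWithinAt (u x) (P (fun x' ↦ u x' t) x) (Icc 0 ε) t

/-- **Hamilton's short-time existence theorem from the quasilinear parabolic existence theorem**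
— the assembly of the decomposition of `ricciFlow_shortTime_existence` into its one remaining
leaf: it is `ricciFlow_shortTime_existence_of_quasilinear` (`RicciDeTurckShortTime.lean`: DeTurck's
trick, Topping 2006, §5.2, Steps 1–2, all proved in the tree) applied to the named input.
[cite: Hamilton1982, Thm. 4.2] [cite: Topping2006, §5.2, Step 1 and Thm. 5.2.1]
[cite: MantegazzaMartinazzi2012, Thm. 1.1] -/
theorem ricciFlow_shortTime_existence_holds_of
    (h : quasilinearParabolic_shortTime_existence.{u, v, w}) :
    ricciFlow_shortTime_existence.{u, v, w} :=
  ricciFlow_shortTime_existence_of_quasilinear @h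

end Literature.Geometry.Riemannian

end
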